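/-
Copyright (c) 2026 The HCML crux team. All rights reserved.
Released under Apache 2.0 license as described in the file LICENSE.
Authors: K2E3-p23 (g5) (explicit-unit `hodgecm-mathlib-K2E3-p23-g5`)
-/
import Summits.HodgeConjecture.HodgeConjecture.Theorems.K2E3GL3FinConjModCocompact     -- ★ (B1) p857737 + ED. 2 p857796 (this seat): `finConjModCocompact_cc`, `measurable_lintegral_conj`; brings ★ B0a, B0a-U, F2, FC-A
import Mathlib.Topology.UrysohnsLemma
import HarnessLib

/-!
# (GL-[M6]-sc, B3) The ELLIPTIC-SET package of the truncated-character domination at `G_Λ = GL₃(F) ⧸ Λ·1` — almost-everywhere form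

Cell `hodgecm-mathlib`, Track B, line `K2_E3_EllipticInputs`; payer «GL-[M6]-sc» of leaf (11-3-split-sc) (dealer K2E3-plan (g3) D63, line lead K2E3-p23
(g4 → g5), RULINGS #1 (M1-2) brick B3).  Harish-Chandra's domination of the truncated orbital integrals `Θ_n(g) = ∫_{Ω n} θ(x g x⁻¹) dx` of a compactly supported
continuous `θ` (a supercuspidal coefficient) splits the group into the elements with COMPACT centraliser (the elliptic set) and the rest.  This file supplies the
elliptic half of the inputs of ★ `truncated_dominated_of_bricks` ∕ ★ p856074 at `G_Λ`, in an ALMOST-EVERYWHERE form that needs neither Harish-Chandra's Lemma 14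
nor regularity: the finiteness ★ (FC) of road «FC» does all the work.

* §1 (generic, unimodular `G`) **`isCompact_conjPreimage_of_lintegral_conj_lt_top`** — if `∫⁻ β(x g x⁻¹) dμ(x) < ⊤` for a continuous `β ≥ 1` on the compact `C`,
  then the fibre `{x | x g x⁻¹ ∈ C}` is COMPACT (else `W · fibre`, `W ∋ 1` open with `W C W⁻¹ ⊆ {β > ½}`, has infinite measure ★ FC-A, against Markov).
* §2 (generic) **`ae_lintegral_conj_lt_top_of_isCompact_centralizer`** — (FC) over the compact-centraliser domain ⇒ `∫⁻ β(xgx⁻¹) < ⊤` for a.e. `g` with compact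
  centraliser (compact exhaustion + `ae_lt_top`; no measurability of the elliptic set needed).
* §3 (generic) **`exists_ellWeight_of_finConj_cc`** — for `θ ∈ C_c(G, ℂ)` and a compact exhaustion `Ω`: a weight `W_E ∈ L¹_loc(μ)`, `W_E ≥ 0`, such that for a.e. `g`
  with compact centraliser the fibre over `tsupport θ` is compact, lies in some `Ω R`, the truncated orbital integrals LOCALISE to `Ω R` uniformly in `n`, CONVERGE
  (they are eventually constant `= ∫ θ(xgx⁻¹)`), and `∫_{Ω R} ‖θ(xgx⁻¹)‖ ≤ W_E(g)` — the `hcancE` ∕ `hballE` ∕ elliptic `hlim` inputs.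
* §4 **`exists_ellWeight_quotScalar`** — §3 at `G_Λ` (★ B1 `finConjModCocompact_cc`, ★ B0a-U unimodularity).

HONEST LABEL: HC_CM is proved only modulo the 7 printed citations (2 remaining named inputs: hLiu418 = stmt-HodgeConjecture-24832, h413 =
stmt-HodgeConjecture-24833) until rung 0 closes; count-neutral (kernel lane `--supports stmt-HodgeConjecture-24833 --as helper`), THEOREMS ONLY; the NON-elliptic half
(Harish-Chandra's Theorems 18–20 at `G_Λ`) is brick B4 and is NOT here.

References: Harish-Chandra (van Dijk) 1970, Part V §4 Lemma 22 p. 48, Part VI §8 Theorem 14 p. 60, Part VII §3 pp. 70–73 [cite: HarishChandra1970, Part VII §3 p. 72];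
Folland 1995 §2.2, §2.4 [cite: Folland1995, §2.4]; Rogawski 1990 §12.5 p. 182 [cite: Rogawski1990, §12.5 p. 182].
-/

open MeasureTheory MeasureTheory.Measure Set Function Filter
open scoped NNReal ENNReal MatrixGroups Pointwise WithZero Valued Topology
open Matrix
open Literature.NumberTheory.Automorphic Literature.NumberTheory.GaloisRepresentations Literature.NumberTheory.GaloisRepresentations.IsNonarchimedeanLocalField
open Summit.HodgeConjecture.HodgeConjecture.Cruxes.H413.K2E3GL3ModCentre Summit.HodgeConjecture.HodgeConjecture.Cruxes.H413.K2E3GL3ModCocompactCentral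
open Summit.HodgeConjecture.HodgeConjecture.Cruxes.H413.K2E3GL3FinConjModCocompact

set_option linter.dupNamespace false

noncomputable section

namespace Summit.HodgeConjecture.HodgeConjecture.Cruxes.H413.K2E3GL3ModCocompactEllPackage

/-! ## §1 Finite fibre integral ⇒ compact fibre (generic, unimodular) -/

section FibreCompact

variable {G : Type*} [Group G] [TopologicalSpace G] [IsTopologicalGroup G] [LocallyCompactSpace G] [T2Space G]
  [MeasurableSpace G] [BorelSpace G] (μ : Measure G) [μ.IsHaarMeasure] [μ.IsMulRightInvariant]

/-- **FINITE FIBRE INTEGRAL ⇒ COMPACT FIBRE.**  `β ≥ 0` continuous with `β ≥ 1` on the compact `C`; if `∫⁻ β(x g x⁻¹) dμ(x) < ⊤` then `{x | x g x⁻¹ ∈ C}` is compact: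
choose an open `W ∋ 1` with `W C W⁻¹ ⊆ U := {β > ½}` (two-sided `compact_open_separated_mul`); then `W · {x | xgx⁻¹ ∈ C} ⊆ {x | xgx⁻¹ ∈ U}` has measure
`≤ 2 ∫⁻ β(xgx⁻¹) < ⊤` (Markov), whereas for a closed NON-compact fibre it would be `⊤` (★ FC-A `measure_mul_eq_top_of_isClosed_not_isCompact`).
[cite: HarishChandra1970, Part V §4 Lemma 22 p. 48] [cite: Folland1995, §2.4] -/
theorem isCompact_conjPreimage_of_lintegral_conj_lt_top {β : G → ℝ≥0∞} (hβ : Continuous β) {C : Set G} (hC : IsCompact C)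
    (hβC : ∀ y ∈ C, 1 ≤ β y) {g : G} (hfin : ∫⁻ x, β (x * g * x⁻¹) ∂μ < ⊤) :
    IsCompact {x : G | x * g * x⁻¹ ∈ C} := by
  -- the open `U = {β > ½} ⊇ C`, an open `U₁ ⊇ C` with compact closure inside `U`, and `W ∋ 1` open with `W C W⁻¹ ⊆ U`
  have hUo : IsOpen {y : G | (2 : ℝ≥0∞)⁻¹ < β y} := isOpen_lt continuous_const hβ
  have h21 : (2 : ℝ≥0∞)⁻¹ < 1 := ENNReal.inv_lt_one.2 ENNReal.one_lt_two
  have hCU : C ⊆ {y : G | (2 : ℝ≥0∞)⁻¹ < β y} := fun y hy => lt_of_lt_of_le h21 (hβC y hy)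
  obtain ⟨U₁, hU₁o, hCU₁, hU₁U, hU₁c⟩ := exists_open_between_and_isCompact_closure hC hUo hCU
  obtain ⟨V₁, hV₁, hV₁C⟩ := compact_open_separated_mul_left hC hU₁o hCU₁
  obtain ⟨V₂, hV₂, hV₂U⟩ := compact_open_separated_mul_right hU₁c hUo hU₁U
  have hWo : IsOpen (interior (V₁ ∩ V₂⁻¹)) := isOpen_interior
  have hWne : (interior (V₁ ∩ V₂⁻¹)).Nonempty := ⟨1, mem_interior_iff_mem_nhds.2 (Filter.inter_mem hV₁ (inv_mem_nhds_one G hV₂))⟩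
  -- `W · fibre ⊆ {x | xgx⁻¹ ∈ U}`
  have hsub : interior (V₁ ∩ V₂⁻¹) * {x : G | x * g * x⁻¹ ∈ C} ⊆ {x : G | (2 : ℝ≥0∞)⁻¹ < β (x * g * x⁻¹)} := by
    rintro _ ⟨w, hw, x, hx, rfl⟩
    have hw' : w ∈ V₁ ∩ V₂⁻¹ := interior_subset hw
    have h1 : w * (x * g * x⁻¹) ∈ U₁ := hV₁C (Set.mul_mem_mul hw'.1 hx)
    have h2 : w * (x * g * x⁻¹) * w⁻¹ ∈ {y : G | (2 : ℝ≥0∞)⁻¹ < β y} := hV₂U (Set.mul_mem_mul (subset_closure h1) (Set.mem_inv.1 hw'.2))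
    have heq : w * x * g * (w * x)⁻¹ = w * (x * g * x⁻¹) * w⁻¹ := by group
    show (2 : ℝ≥0∞)⁻¹ < β (w * x * g * (w * x)⁻¹)
    rw [heq]; exact h2
  -- `μ {x | xgx⁻¹ ∈ U} < ⊤` (Markov)
  have hmeas : AEMeasurable (fun x : G => β (x * g * x⁻¹)) μ :=
    (hβ.comp ((continuous_id.mul continuous_const).mul continuous_id.inv)).measurable.aemeasurable
  have hfinU : μ {x : G | (2 : ℝ≥0∞)⁻¹ < β (x * g * x⁻¹)} < ⊤ := by
    refine lt_of_le_of_lt (measure_mono fun x (hx : (2 : ℝ≥0∞)⁻¹ < β (x * g * x⁻¹)) => (le_of_lt hx : (2 : ℝ≥0∞)⁻¹ ≤ β (x * g * x⁻¹))) ?_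
    refine lt_of_le_of_lt (meas_ge_le_lintegral_div hmeas (ENNReal.inv_ne_zero.2 ENNReal.ofNat_ne_top) (ENNReal.inv_ne_top.2 two_ne_zero)) ?_
    exact ENNReal.div_lt_top hfin.ne (ENNReal.inv_ne_zero.2 ENNReal.ofNat_ne_top)
  -- the fibre is closed; if it were not compact, `μ (W · fibre) = ⊤`
  have hΦc : IsClosed {x : G | x * g * x⁻¹ ∈ C} := hC.isClosed.preimage ((continuous_id.mul continuous_const).mul continuous_id.inv)
  by_contra hΦ
  have htop := K2E3ConjFibreInfinite.measure_mul_eq_top_of_isClosed_not_isCompact μ hWo hWne hΦc hΦ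
  have hlt := (measure_mono hsub).trans_lt hfinU
  rw [htop] at hlt
  exact lt_irrefl _ hlt

end FibreCompact

/-! ## §2 (FC) over the compact-centraliser domain ⇒ finiteness of the fibre integral a.e. on the elliptic set (generic) -/

section AeFinite

variable {G : Type*} [Group G] [TopologicalSpace G] [SigmaCompactSpace G] [MeasurableSpace G] (μ : Measure G)

/-- **`∫⁻ β(xgx⁻¹) < ⊤` for a.e. `g` with compact centraliser**, from `∫⁻_{C ∩ {Z compact}} ∫⁻ β(xgx⁻¹) < ⊤` for every compact `C` (compact exhaustion, `ae_lt_top`;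
the elliptic set need not be measurable — `Measure.restrict_apply` only needs the measurability of `{W = ⊤}`). [cite: HarishChandra1970, Part VII §3 p. 72] -/
theorem ae_lintegral_conj_lt_top_of_isCompact_centralizer {β : G → ℝ≥0∞} (hWm : Measurable fun g : G => ∫⁻ x, β (x * g * x⁻¹) ∂μ)
    (hFC : ∀ {C : Set G}, IsCompact C →
      ∫⁻ g in C ∩ {h : G | IsCompact ((Subgroup.centralizer ({h} : Set G)) : Set G)}, ∫⁻ x, β (x * g * x⁻¹) ∂μ ∂μ < ⊤) :
    ∀ᵐ g ∂μ, IsCompact ((Subgroup.centralizer ({g} : Set G)) : Set G) → ∫⁻ x, β (x * g * x⁻¹) ∂μ < ⊤ := by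
  rw [ae_iff]
  have hT : MeasurableSet {g : G | ¬ ∫⁻ x, β (x * g * x⁻¹) ∂μ < ⊤} := (measurableSet_lt hWm measurable_const).compl
  have hsub : {g : G | ¬ (IsCompact ((Subgroup.centralizer ({g} : Set G)) : Set G) → ∫⁻ x, β (x * g * x⁻¹) ∂μ < ⊤)} ⊆
      ⋃ n : ℕ, {g : G | ¬ ∫⁻ x, β (x * g * x⁻¹) ∂μ < ⊤} ∩ (compactCovering G n ∩ {h : G | IsCompact ((Subgroup.centralizer ({h} : Set G)) : Set G)}) := by
    intro g hg
    rw [mem_setOf_eq, Classical.not_imp] at hg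
    obtain ⟨n, hn⟩ := exists_mem_compactCovering g
    exact Set.mem_iUnion.2 ⟨n, hg.2, hn, hg.1⟩
  refine measure_mono_null hsub (measure_iUnion_null fun n => ?_)
  rw [← Measure.restrict_apply hT]
  exact ae_iff.1 (ae_lt_top hWm (hFC (isCompact_compactCovering G n)).ne)

end AeFinite

/-! ## §3 The elliptic package from (FC) (generic, unimodular second-countable `G`) -/

section Generic

variable {G : Type*} [Group G] [TopologicalSpace G] [IsTopologicalGroup G] [LocallyCompactSpace G] [T2Space G] [SecondCountableTopology G]
  [MeasurableSpace G] [BorelSpace G] (μ : Measure G) [μ.IsHaarMeasure] [μ.IsMulRightInvariant]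

/-- **THE ELLIPTIC PACKAGE FROM (FC).**  `G` unimodular, locally compact, Hausdorff, second countable; (FC) over the compact-centraliser domain for every compact `C`
and every continuous compactly supported bounded `β ≥ 0`.  For `θ ∈ C_c(G, ℂ)` and a compact exhaustion `Ω`, with a Urysohn bump `f = 1` on `tsupport θ` and
`W(g) := ∫⁻ f(xgx⁻¹) dμ`, the weight **`W_E := M_θ · W.toReal ∈ L¹_loc(μ)`** (`‖W.toReal‖ₑ ≤ 1_{Zc}·W` by ★ F2, then (FC)); and for a.e. `g` with compact centraliser
(`W(g) < ⊤` a.e. there, §2): the fibre `{x | xgx⁻¹ ∈ tsupport θ}` is compact (§1), inside some `Ω R`, so `∫_{Ω n} θ(xgx⁻¹) = ∫_{Ω n ∩ Ω R} θ(xgx⁻¹)` for all `n`,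
the truncated orbital integrals are eventually `= ∫_{Ω R} θ(xgx⁻¹) = ∫ θ(xgx⁻¹)`, and `∫_{Ω R} ‖θ(xgx⁻¹)‖ ≤ W_E(g)`.
[cite: HarishChandra1970, Part VII §3 p. 72] [cite: Folland1995, §2.4] [cite: Rogawski1990, §12.5 p. 182] -/
theorem exists_ellWeight_of_finConj_cc
    (hFC : ∀ {C : Set G}, IsCompact C → ∀ {β : G → ℝ≥0∞}, Continuous β → IsCompact (tsupport β) → ∀ {Mb : ℝ≥0∞}, Mb ≠ ⊤ → (∀ g, β g ≤ Mb) →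
      ∫⁻ g in C ∩ {h : G | IsCompact ((Subgroup.centralizer ({h} : Set G)) : Set G)}, ∫⁻ x, β (x * g * x⁻¹) ∂μ ∂μ < ⊤)
    {θ : G → ℂ} (hθ : Continuous θ) (hθs : HasCompactSupport θ) (Ω : CompactExhaustion G) :
    ∃ W_E : G → ℝ, LocallyIntegrable W_E μ ∧ (∀ g, 0 ≤ W_E g) ∧
      ∀ᵐ g ∂μ, IsCompact ((Subgroup.centralizer ({g} : Set G)) : Set G) →
        IsCompact {x : G | x * g * x⁻¹ ∈ tsupport θ} ∧
        ∃ R : ℕ, {x : G | x * g * x⁻¹ ∈ tsupport θ} ⊆ Ω R ∧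
          (∀ n : ℕ, ∫ x in Ω n, θ (x * g * x⁻¹) ∂μ = ∫ x in Ω n ∩ Ω R, θ (x * g * x⁻¹) ∂μ) ∧
          Tendsto (fun n : ℕ => ∫ x in Ω n, θ (x * g * x⁻¹) ∂μ) atTop (𝓝 (∫ x in Ω R, θ (x * g * x⁻¹) ∂μ)) ∧
          (∫ x in Ω R, θ (x * g * x⁻¹) ∂μ = ∫ x, θ (x * g * x⁻¹) ∂μ) ∧
          ∫ x in Ω R, ‖θ (x * g * x⁻¹)‖ ∂μ ≤ W_E g := by
  haveI : SigmaCompactSpace G := sigmaCompactSpace_of_locallyCompact_secondCountable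
  -- the bound `M` of `θ`, the Urysohn bump `f = 1` on `tsupport θ`, `β = ofReal ∘ f`, the fibre integral `W`
  obtain ⟨M₀, hM₀⟩ := hθ.bounded_above_of_compact_support hθs
  set M : ℝ := max M₀ 0 with hM
  have hM0 : 0 ≤ M := le_max_right _ _
  have hθM : ∀ y, ‖θ y‖ ≤ M := fun y => (hM₀ y).trans (le_max_left _ _)
  obtain ⟨f, hf1, -, hfcs, hf01⟩ := exists_continuous_one_zero_of_isCompact hθs.isCompact isClosed_empty (Set.disjoint_empty _)
  have hfc : Continuous fun y : G => ENNReal.ofReal (f y) := ENNReal.continuous_ofReal.comp f.continuous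
  have hfcs' : IsCompact (tsupport fun y : G => ENNReal.ofReal (f y)) := (hfcs.comp_left ENNReal.ofReal_zero).isCompact
  have hf1' : ∀ y, ENNReal.ofReal (f y) ≤ 1 := fun y => ENNReal.ofReal_le_one.2 (hf01 y).2
  have hfS : ∀ y ∈ tsupport θ, 1 ≤ ENNReal.ofReal (f y) := fun y hy => by rw [hf1 hy, Pi.one_apply, ENNReal.ofReal_one]
  have hθf : ∀ y, ‖θ y‖ ≤ M * f y := fun y => by
    by_cases hy : y ∈ tsupport θ
    · rw [hf1 hy, Pi.one_apply, mul_one]; exact hθM y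
    · rw [image_eq_zero_of_notMem_tsupport hy, norm_zero]; exact mul_nonneg hM0 (hf01 y).1
  have hWm : Measurable fun g : G => ∫⁻ x, ENNReal.ofReal (f (x * g * x⁻¹)) ∂μ := measurable_lintegral_conj μ hfc
  have hconjm : ∀ g : G, Measurable fun x : G => ENNReal.ofReal (f (x * g * x⁻¹)) := fun g =>
    (hfc.comp ((continuous_id.mul continuous_const).mul continuous_id.inv)).measurable
  -- the weight
  refine ⟨fun g => M * (∫⁻ x, ENNReal.ofReal (f (x * g * x⁻¹)) ∂μ).toReal, ?_, fun g => mul_nonneg hM0 ENNReal.toReal_nonneg, ?_⟩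
  · -- local integrability: `‖W.toReal‖ₑ ≤ 1_{Zc} · W` (★ F2), `∫⁻_C 1_{Zc} W ≤ ∫⁻_{C ∩ Zc} W < ⊤` (FC)
    have hw : LocallyIntegrable (fun g : G => (∫⁻ x, ENNReal.ofReal (f (x * g * x⁻¹)) ∂μ).toReal) μ := by
      rw [locallyIntegrable_iff]
      intro C hC
      refine ⟨hWm.ennreal_toReal.aestronglyMeasurable, ?_⟩
      rw [hasFiniteIntegral_iff_enorm]
      have hle : ∀ g : G, ‖(∫⁻ x, ENNReal.ofReal (f (x * g * x⁻¹)) ∂μ).toReal‖ₑ ≤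
          {h : G | IsCompact ((Subgroup.centralizer ({h} : Set G)) : Set G)}.indicator (fun g => ∫⁻ x, ENNReal.ofReal (f (x * g * x⁻¹)) ∂μ) g := by
        intro g
        rw [Real.enorm_eq_ofReal ENNReal.toReal_nonneg]
        by_cases htop : ∫⁻ x, ENNReal.ofReal (f (x * g * x⁻¹)) ∂μ < ⊤
        · by_cases hex : ∃ x, ENNReal.ofReal (f (x * g * x⁻¹)) ≠ 0
          · obtain ⟨x, hx⟩ := hex
            rw [Set.indicator_of_mem (K2E3FinConjFibreReduction.isCompact_centralizer_of_lintegral_conj_lt_top μ hfc htop hx)]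
            exact ENNReal.ofReal_toReal_le
          · push Not at hex
            have h0 : ∫⁻ x, ENNReal.ofReal (f (x * g * x⁻¹)) ∂μ = 0 := by simp [hex]
            rw [h0, ENNReal.toReal_zero, ENNReal.ofReal_zero]; exact bot_le
        · rw [not_lt, top_le_iff] at htop
          rw [htop, ENNReal.toReal_top, ENNReal.ofReal_zero]; exact bot_le
      calc ∫⁻ g in C, ‖(∫⁻ x, ENNReal.ofReal (f (x * g * x⁻¹)) ∂μ).toReal‖ₑ ∂μ
          ≤ ∫⁻ g in C, {h : G | IsCompact ((Subgroup.centralizer ({h} : Set G)) : Set G)}.indicator (fun g => ∫⁻ x, ENNReal.ofReal (f (x * g * x⁻¹)) ∂μ) g ∂μ :=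
            lintegral_mono fun g => hle g
        _ ≤ ∫⁻ g in {h : G | IsCompact ((Subgroup.centralizer ({h} : Set G)) : Set G)}, ∫⁻ x, ENNReal.ofReal (f (x * g * x⁻¹)) ∂μ ∂(μ.restrict C) :=
            lintegral_indicator_le _ _
        _ = ∫⁻ g in C ∩ {h : G | IsCompact ((Subgroup.centralizer ({h} : Set G)) : Set G)}, ∫⁻ x, ENNReal.ofReal (f (x * g * x⁻¹)) ∂μ ∂μ := by
            rw [Measure.restrict_restrict' hC.isClosed.measurableSet, Set.inter_comm]
        _ < ⊤ := hFC hC hfc hfcs' ENNReal.one_ne_top hf1'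
    exact hw.smul M
  · -- the a.e. statement
    have hae := ae_lintegral_conj_lt_top_of_isCompact_centralizer μ hWm (fun hC => hFC hC hfc hfcs' ENNReal.one_ne_top hf1')
    filter_upwards [hae] with g hg hZ
    have hfin : ∫⁻ x, ENNReal.ofReal (f (x * g * x⁻¹)) ∂μ < ⊤ := hg hZ
    have hF : IsCompact {x : G | x * g * x⁻¹ ∈ tsupport θ} := isCompact_conjPreimage_of_lintegral_conj_lt_top μ hfc hθs.isCompact hfS hfin
    obtain ⟨R, hR⟩ := Ω.exists_superset_of_isCompact hF
    have hzero : ∀ x : G, x ∉ Ω R → θ (x * g * x⁻¹) = 0 := fun x hx =>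
      image_eq_zero_of_notMem_tsupport fun h => hx (hR h)
    have hloc : ∀ n : ℕ, ∫ x in Ω n, θ (x * g * x⁻¹) ∂μ = ∫ x in Ω n ∩ Ω R, θ (x * g * x⁻¹) ∂μ := fun n =>
      setIntegral_eq_of_subset_of_forall_sdiff_eq_zero (Ω.isCompact n).isClosed.measurableSet Set.inter_subset_left
        fun x hx => hzero x fun h => hx.2 ⟨hx.1, h⟩
    have hfull : ∫ x in Ω R, θ (x * g * x⁻¹) ∂μ = ∫ x, θ (x * g * x⁻¹) ∂μ := setIntegral_eq_integral_of_forall_compl_eq_zero hzero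
    refine ⟨hF, R, hR, hloc, ?_, hfull, ?_⟩
    · refine tendsto_atTop_of_eventually_const (i₀ := R) fun n hn => ?_
      rw [hloc n, Set.inter_eq_right.2 (Ω.subset hn)]
    · -- `∫_{Ω R} ‖θ(xgx⁻¹)‖ ≤ ∫ M f(xgx⁻¹) = M · W(g).toReal`
      have hint_f : Integrable (fun x : G => f (x * g * x⁻¹)) μ := by
        refine ⟨(f.continuous.comp ((continuous_id.mul continuous_const).mul continuous_id.inv)).aestronglyMeasurable, ?_⟩
        rw [hasFiniteIntegral_iff_enorm]
        calc ∫⁻ x, ‖f (x * g * x⁻¹)‖ₑ ∂μ = ∫⁻ x, ENNReal.ofReal (f (x * g * x⁻¹)) ∂μ :=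
              lintegral_congr fun x => Real.enorm_eq_ofReal (hf01 _).1
          _ < ⊤ := hfin
      have hint_θ : Integrable (fun x : G => ‖θ (x * g * x⁻¹)‖) μ := by
        refine (hint_f.const_mul M).mono' (hθ.comp ((continuous_id.mul continuous_const).mul continuous_id.inv)).norm.aestronglyMeasurable ?_
        exact Eventually.of_forall fun x => by rw [norm_norm]; exact hθf _
      calc ∫ x in Ω R, ‖θ (x * g * x⁻¹)‖ ∂μ ≤ ∫ x, ‖θ (x * g * x⁻¹)‖ ∂μ := setIntegral_le_integral hint_θ (Eventually.of_forall fun x => norm_nonneg _)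
        _ ≤ ∫ x, M * f (x * g * x⁻¹) ∂μ := integral_mono hint_θ (hint_f.const_mul M) fun x => hθf _
        _ = M * ∫ x, f (x * g * x⁻¹) ∂μ := integral_const_mul M _
        _ = M * (∫⁻ x, ENNReal.ofReal (f (x * g * x⁻¹)) ∂μ).toReal := by
            rw [integral_eq_lintegral_of_nonneg_ae (Eventually.of_forall fun x => (hf01 _).1) hint_f.aestronglyMeasurable]

end Generic

/-! ## §4 At `G_Λ = GL₃(F) ⧸ Λ·1` -/

section QuotScalar

/-- **(GL-[M6]-sc, B3) THE ELLIPTIC PACKAGE AT `G_Λ`**: for `Λ ≤ F^×` closed with `F^× ⧸ Λ` compact, a Haar measure `μ` on `G_Λ = GL₃(F) ⧸ Λ·1`, `θ ∈ C_c(G_Λ, ℂ)`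
and a compact exhaustion `Ω` of `G_Λ`: the weight `W_E ∈ L¹_loc(μ)`, `W_E ≥ 0`, and for a.e. `g` with compact centraliser the localisation ∕ convergence ∕ ball
bound of the truncated orbital integrals `∫_{Ω n} θ(xgx⁻¹) dμ` (§3 over ★ B1 `finConjModCocompact_cc` and ★ B0a-U).  These are the `hcancE`, `hballE` and
elliptic-`hlim` inputs of ★ `truncated_dominated_of_bricks` ∕ ★ p856074 on road «GL-[M6]-sc». [cite: HarishChandra1970, Part VII §3 p. 72] [cite: Rogawski1990, §12.5 p. 182] -/
theorem exists_ellWeight_quotScalar {F : Type*} [Field F] [Valued F ℤᵐ⁰] [ValuativeRel F] [(Valued.v : Valuation F ℤᵐ⁰).Compatible] [IsNonarchimedeanLocalField F]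
    [CharZero F] {ϖ : F} (hϖ : Valued.v ϖ = WithZero.exp (-1 : ℤ))
    (Λ₀ : Subgroup Fˣ) [(Λ₀.map (Matrix.GeneralLinearGroup.scalar (Fin 3))).Normal] (hΛ : IsClosed (Λ₀ : Set Fˣ)) [CompactSpace (Fˣ ⧸ Λ₀)]
    [MeasurableSpace (GL (Fin 3) F ⧸ Λ₀.map (Matrix.GeneralLinearGroup.scalar (Fin 3)))] [BorelSpace (GL (Fin 3) F ⧸ Λ₀.map (Matrix.GeneralLinearGroup.scalar (Fin 3)))]
    (μ : Measure (GL (Fin 3) F ⧸ Λ₀.map (Matrix.GeneralLinearGroup.scalar (Fin 3)))) [μ.IsHaarMeasure]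
    {θ : (GL (Fin 3) F ⧸ Λ₀.map (Matrix.GeneralLinearGroup.scalar (Fin 3))) → ℂ} (hθ : Continuous θ) (hθs : HasCompactSupport θ)
    (Ω : CompactExhaustion (GL (Fin 3) F ⧸ Λ₀.map (Matrix.GeneralLinearGroup.scalar (Fin 3)))) :
    ∃ W_E : (GL (Fin 3) F ⧸ Λ₀.map (Matrix.GeneralLinearGroup.scalar (Fin 3))) → ℝ, LocallyIntegrable W_E μ ∧ (∀ g, 0 ≤ W_E g) ∧
      ∀ᵐ g ∂μ, IsCompact ((Subgroup.centralizer ({g} : Set (GL (Fin 3) F ⧸ Λ₀.map (Matrix.GeneralLinearGroup.scalar (Fin 3))))) :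
          Set (GL (Fin 3) F ⧸ Λ₀.map (Matrix.GeneralLinearGroup.scalar (Fin 3)))) →
        IsCompact {x : GL (Fin 3) F ⧸ Λ₀.map (Matrix.GeneralLinearGroup.scalar (Fin 3)) | x * g * x⁻¹ ∈ tsupport θ} ∧
        ∃ R : ℕ, {x : GL (Fin 3) F ⧸ Λ₀.map (Matrix.GeneralLinearGroup.scalar (Fin 3)) | x * g * x⁻¹ ∈ tsupport θ} ⊆ Ω R ∧
          (∀ n : ℕ, ∫ x in Ω n, θ (x * g * x⁻¹) ∂μ = ∫ x in Ω n ∩ Ω R, θ (x * g * x⁻¹) ∂μ) ∧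
          Tendsto (fun n : ℕ => ∫ x in Ω n, θ (x * g * x⁻¹) ∂μ) atTop (𝓝 (∫ x in Ω R, θ (x * g * x⁻¹) ∂μ)) ∧
          (∫ x in Ω R, θ (x * g * x⁻¹) ∂μ = ∫ x, θ (x * g * x⁻¹) ∂μ) ∧
          ∫ x in Ω R, ‖θ (x * g * x⁻¹)‖ ∂μ ≤ W_E g := by
  haveI : SecondCountableTopology (GL (Fin 3) F) := secondCountableTopology_gl3 F
  haveI : LocallyCompactSpace (GL (Fin 3) F) := locallyCompactSpace_gl3 F
  haveI : T2Space (GL (Fin 3) F ⧸ Λ₀.map (Matrix.GeneralLinearGroup.scalar (Fin 3))) := t2Space_quotScalar Λ₀ hΛ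
  haveI : μ.IsMulRightInvariant := K2E3GL3ModCocompactUnimodular.isMulRightInvariant_quotScalar_of_isHaarMeasure Λ₀ hΛ hϖ μ
  exact exists_ellWeight_of_finConj_cc μ (fun hC _ hβ hβs _ hMb hβM => finConjModCocompact_cc hϖ Λ₀ μ hC hβs hMb hβM) hθ hθs Ω

end QuotScalar

end Summit.HodgeConjecture.HodgeConjecture.Cruxes.H413.K2E3GL3ModCocompactEllPackage

end
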